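import Summits.BirchSwinnertonDyer.BirchSwinnertonDyer.Theorems.QuadraticBranchSignedControlPlusKatoDivisibilityBranchOntoOfFacts
import Summits.BirchSwinnertonDyer.BirchSwinnertonDyer.Theorems.QuadraticBranchSignedControlPlusLowerInclusionSurjBranchOfZeta
import Summits.BirchSwinnertonDyer.BirchSwinnertonDyer.Theorems.QuadraticBranchSignedControlPlusMainConjectureNonsurjBranchOfEta
import Summits.BirchSwinnertonDyer.BirchSwinnertonDyer.Theorems.QuadraticBranchSignedControlEtaDescentFrameSurj
import Summits.BirchSwinnertonDyer.BirchSwinnertonDyer.Theorems.QuadraticBranchSignedControlEtaDescentFrameNonsurj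
import Summits.BirchSwinnertonDyer.BirchSwinnertonDyer.Theorems.QuadraticBranchSignedControlGss2Assembly
import HarnessLib

/-!
# K8 route `QuadraticBranchSignedControl`: the rung leaf `O5SharpGss` from its MINIMAL bill of named facts and
# open cruxes — `{Kobayashi zeta-eta package, Kato 13.4, Kobayashi 1.2, Kitajima–Otsuki 1.3, the Gss2
# published inputs}` + `{(E⁺_η) on onto rows, (C1_η) on non-onto rows, p-adic Gross–Zagier, p = 3}` — through
# the route's OWN deciding theorem `closes` (glue v2), every other route item DISCHARGED by a tree theorem

Cell `bsd-potss` (HOME `run/shared/lean/pub/bsd-potss/`), seat `bsd-potss-k8q-c2x` g4 (prover; lane B of the K8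
Kato side; director-bsd g8 2026-08-27: "signed Coleman maps giving Kato divisibility in the plus theory BY
NAME"). HONEST FRAMING: the programme assembles BSD for analytic rank `≤ 1` strictly from published theorems and
types the remainder; BSD is not proved by any of this; the theorems below are CONDITIONAL on named Literature
facts AND on the route's open crux items, all displayed as hypotheses; the rung leaf is not closed by them;
nothing is booked; BSD is claimed for no curve.

## What (a kernel certificate of the route's bill of materials after rev 23 + this seat's two glues)

`o5SharpGss_of_bill`: **`O5SharpGss`** (the K8 rung leaf) from EXACTLY
* three Kato-side named facts: `hZ` = `Kobayashi2003.thm62_63_73_etaColemanPoitouTate_zeta` (Kobayashi 2003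
  Thm. 6.2/6.3/7.3 i)/Cor. 7.2 at `η`, `z` a genuine Euler-system class), `h134` =
  `Kato2004.thm13_4_lengthAt_fineSelmerDual_le_of_isEulerSystemClass` (Kato Thm. 13.4), `h12` =
  `Kobayashi2003.thm12_signedSelmerDual_finite_torsion` (Kobayashi Thm. 1.2);
* the held published inputs `hKO : PublishedInputKO13` (Kitajima–Otsuki Main Thm. 1.3) and `hP : PublishedInputsGss2`
  (modularity / newform, Poitou–Tate over `ℝ`-data, Manin odd, entire `L`, Gross–Zagier I.7.3, rank = analytic
  rank `≤ 1` — the route's own alias bundle);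
* the route's OPEN cruxes in node currency: `hEη : PlusEtaLowerInclusion` (item 19601, the Eisenstein inclusion
  at `η` on tower-onto rows), `hCη : PlusEtaMainConjectureNonsurj` (item 19606, the even main conjecture at
  `η` on the non-onto rows), `h₄ : PAdicGrossZagierBranch` (item 19116), and the declared `p = 3` residual
  `hR : Gss2AtThree` (item 19120);
and NOTHING ELSE — the other inputs of `closes` are discharged by tree theorems: `PlusKatoDivisibilityBranchOnto`
(crux 20445) by `KatoSideOnto.plusKatoDivisibilityBranchOnto_of_zeta_of_thm13_4_of_thm12` (p553368);
`PlusLowerInclusionSurjBranch` by `KatoSideOnto.plusLowerInclusionSurjBranch_of_eta_of_thm12_of_zeta`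
(p553746; NO Thm. 2.2η input) over `etaDescentFrameSurj_proof`; `PlusMainConjectureNonsurjBranch` by glue
`plusMainConjectureNonsurjBranchOfEta_proof` over `etaDescentFrameNonsurj_proof`; `EtaTransportSigned` (crux
19115, held at 19584 = Kobayashi Thm. 7.4η) by `Thm74Skeleton.etaTransportSigned_of_etaColemanPoitouTate` over
the projection `thm62_63_73_etaColemanPoitouTate_of_zeta hZ` — so Kobayashi's Thm. 2.2η (19604), Thm. 7.4η
(19584) and Thm. 4.1η are ALL subsumed by `hZ`; `Gss2Assembly` by `gss2Assembly_proof`.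
Also: `thm74_etaEvenMC_iff_etaOddMC_of_zeta` (Kobayashi Thm. 7.4η — the Literature fact that item 19584's decl
`PublishedInputThm74` aliases — from `hZ`: a one-constant glue should the planner re-type 19584 over the
zeta-eta child; g2's `EulerSystemBound.publishedInputThm74_of_zeta` states the alias form but is RED by import).
For the tenure planner / referee: the K8 deciding chain's Literature trust base is therefore
`{hZ, h134, h12, KO13} ∪ PublishedInputsGss2`, and its open content is `{19601, 19606, 19116, 19120}`.

References: [Kobayashi2003] Thm. 1.2 (p. 2), Thm. 2.2 (p. 5), Thm. 4.1 (p. 8), Thm. 6.2, 6.3 (p. 11), Cor. 7.2,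
Thm. 7.3, Thm. 7.4 (p. 13); [Kato2004Asterisque] Thm. 13.4 (p. 226); [KitajimaOtsuki2018] Main Thm. 1.3;
[GreenbergLNM1716] §3 (descent; reading).
-/

noncomputable section

-- justification: the `Summit.BirchSwinnertonDyer.BirchSwinnertonDyer.…` path repeats a component (route-file convention)
set_option linter.dupNamespace false

open scoped Classical

open Literature.NumberTheory.EllipticCurves
open Summit.BirchSwinnertonDyer.BirchSwinnertonDyer.Theses.QuadraticBranchSignedControl

namespace Summit.BirchSwinnertonDyer.BirchSwinnertonDyer.Theorems

namespace KatoSideOnto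

/-- **Kobayashi 2003 Thm. 7.4 at the quadratic `η` (`thm74_etaEvenMC_iff_etaOddMC`: even ⟺ odd main conjecture
on the `η`-component) FROM the zeta-pinned package `hZ`** — projection `thm62_63_73_etaColemanPoitouTate_of_zeta`,
then the tree's `Thm74Skeleton.thm74_etaEvenMC_iff_etaOddMC_of_etaColemanPoitouTate` (k8q-c3's kernel proof of
Thm. 7.4 from the two `η`-exact sequences). CONDITIONAL on `hZ`. [cite: Kobayashi2003, Thm. 7.4 and its proof (p. 13)] -/
theorem thm74_etaEvenMC_iff_etaOddMC_of_zeta (hZ : Kobayashi2003.thm62_63_73_etaColemanPoitouTate_zeta) :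
    Kobayashi2003.thm74_etaEvenMC_iff_etaOddMC :=
  Thm74Skeleton.thm74_etaEvenMC_iff_etaOddMC_of_etaColemanPoitouTate
    (Kobayashi2003.thm62_63_73_etaColemanPoitouTate_of_zeta hZ)

/-- **The K8 rung leaf `O5SharpGss` from its minimal bill — three Kato-side named facts, Kitajima–Otsuki 1.3, the
Gss2 published-input bundle, and the route's four OPEN statements (19601 (E⁺_η) on onto rows, 19606 (C1_η) on
non-onto rows, 19116 `p`-adic Gross–Zagier, 19120 `p = 3`) — THROUGH THE ROUTE'S OWN `closes` (glue v2)**, with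
`PlusKatoDivisibilityBranchOnto` (p553368), `PlusLowerInclusionSurjBranch` (p553746, no Thm. 2.2η), 
`PlusMainConjectureNonsurjBranch` (glue 19609 + frame 19607), `EtaTransportSigned` (19115/19584, from `hZ`) and
`Gss2Assembly` (19119) discharged by tree theorems. CONDITIONAL on every displayed hypothesis; closes nothing;
BSD for no curve. [cite: Kobayashi2003, Thm. 1.2 (p. 2), Thm. 4.1 (p. 8), Thm. 7.3, Thm. 7.4 (p. 13)]
[cite: Kato2004Asterisque, Thm. 13.4 (p. 226)] [cite: KitajimaOtsuki2018, Main Thm. 1.3] -/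
theorem o5SharpGss_of_bill
    (hZ : Kobayashi2003.thm62_63_73_etaColemanPoitouTate_zeta)
    (h134 : Kato2004.thm13_4_lengthAt_fineSelmerDual_le_of_isEulerSystemClass)
    (h12 : Kobayashi2003.thm12_signedSelmerDual_finite_torsion)
    (hKO : PublishedInputKO13) (hP : PublishedInputsGss2)
    (hEη : PlusEtaLowerInclusion) (hCη : PlusEtaMainConjectureNonsurj)
    (h₄ : PAdicGrossZagierBranch) (hR : Gss2AtThree) :
    Summit.BirchSwinnertonDyer.Rank1Residual.Additive.O5SharpGss :=
  closes (plusKatoDivisibilityBranchOnto_of_zeta_of_thm13_4_of_thm12 hZ h134 h12)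
    (plusLowerInclusionSurjBranch_of_eta_of_thm12_of_zeta hEη etaDescentFrameSurj_proof h12 hZ)
    (plusMainConjectureNonsurjBranchOfEta_proof hCη etaDescentFrameNonsurj_proof h12)
    (Thm74Skeleton.etaTransportSigned_of_etaColemanPoitouTate
      (Kobayashi2003.thm62_63_73_etaColemanPoitouTate_of_zeta hZ))
    h₄ hP hKO gss2Assembly_proof hR

end KatoSideOnto

end Summit.BirchSwinnertonDyer.BirchSwinnertonDyer.Theorems

end
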